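import Literature.MathematicalPhysics.QuantumFieldTheory.Balaban1983to89.B9Eq340ProbeBridgeDstarSN

/-!
# `Balaban1983to89.B9Eq340DirSumReadOff` — T. Bałaban, *Propagators for lattice gauge theories in a background field*, Commun. Math. Phys. **99** (1985) 389–434
# [Balaban1985BackgroundPropagators], (3.8) p. 392 + (3.44) p. 398: the BOND word `∇_U ∘ W ∘ ∇\*_U` read off a DIRECTION-INDEXED FAMILY of site-packed words — the target-side
# read-off (brick B2, sup form) of the `h44G` road, for ANY source class

[4] = T. Bałaban, *Propagators and renormalization transformations for lattice gauge theories. II*, Commun. Math. Phys. **96** (1984) 223–250 [`Balaban1984PropagatorsII`].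
statement-level skeleton of published theorems with citation tags; proofs where landed; nothing here is a claim about the Yang–Mills mass gap.

WHY THIS FILE (cell `pub-ymgap`, node N06 [B9], seat `pub-ymgap-dag-n06-c` g19; road memo `pub-ymgap-dag-n06-c/HPDGW-ROAD.md`, brick B2).  n06-k's (3.44)/(3.45) engine
(`B9RWSums344InputPairDir.inputPair3445_of_local37_dir`) returns, per direction pair `(dir, μ)`, the site-packed word `𝔡.Dd U dir ∘ G′ ∘ 𝔡.Dsd U μ`; composed with the slice
`dirSliceK μ ν` (brick B1, `B9SmoothHolderClassSliceSN`) these are operators `S μ` from the BOND source class into a site-packed `𝔠` class.  The certificate's `h44G` reads the bond word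
`(𝔬12).Dv ∘ GcoS G′ ∘ (𝔬12).Dvstar` = `DvcoKH ∘ GcoS ∘ DvscoKH`, whose value at a bond slot is `γ·Σ_μ` of the `S μ`'s values at the charted base point (def-Y's `∇\*_U = c_fη Σ_μ …`,
`Node00.OpsYNablaBridge`).  THIS FILE is the generic read-off: a family of `𝔠`-class majorants with a common kernel gives the bond word's majorant with the factor `(d+1)|γ|` — for ANY
source class `b₁` (so it applies verbatim to the Hölder source `bHZKP (taxiB U) s` of (3.44)).
* ★★ `hasMaj_bond_of_dirSumFamily` — `(∀ dir ν μ, HasMaj b₁ 𝔠^{(t)}_{blkSK(sIK bI)} (S dir ν μ) (C e^{−δd}))` and `T′ A (⟨x,dir⟩, ν, c, c′) = γ·Σ_μ S dir ν μ A (chart x, μ, c, c′)` ⟹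
  `HasMaj b₁ 𝔠^{(t)}_{blkBK bI} T′ ((d+1)|γ|C e^{−δd})` (direction-blind `bI`); ★ `hasMaj_bond_of_dirSum` (a single `S`).
* §2 ★ `assembleK_GcoS_DscoS_eq`, ★★ `DvGcoSDvs_apply_eq_dirSum` — the read-off identity ITSELF at def-Y's pins: `(DvcoKH ∘ (GcoS O ∘ DvscoKH)) A (⟨x,dir⟩, ν, c, c′) =
  (c_fη)²·Σ_μ ((η⁻¹•coordOpK b (fun _ => ∇_{U,dir})) ∘ (GcoS O ∘ (η⁻¹•coordOpK b (fun _ => ∇\*_{U,μ}))) ∘ dirSliceK μ ν) A (chart x, μ, c, c′)` — the words inside are LITERALLY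
  n06-k's directional words `𝔡.Dd U dir ∘ (𝔬.Gp U ∘ 𝔡.Dsd U μ)` at the certificate's pins `h𝔡d ∕ hGpS ∕ h𝔡s`, precomposed with the slices of brick B1.
HONEST SCOPE.  Linear bookkeeping; no estimate of [B9] asserted; COUNT-NEUTRAL; N06 NOT discharged; nothing continuum, nothing about the mass gap.  Cell `pub-ymgap` (HUMAN RULING D-0062),
Track A node N06 [B9], seat `pub-ymgap-dag-n06-c` (g19), 2026-08-29; a NEW file; 0 `def`, no `sorry`, no `axiom`, no `instance`, no `notation`.
-/

noncomputable section

namespace Literature.MathematicalPhysics.QuantumFieldTheory.Balaban1983to89.B9Eq340DirSumReadOff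

open B6GlobalChartV1 (PV)
open B6KLevelCensusIndexV1 (KIdx)
open B9Thm34Ext (toB6)
open B9GeoNormsKLevelV1 (geo9K)
open B9GeoLemma21KLevelV1 (geo9K_len_pos)
open B9CoReadingCoords (XBK blkBK)
open B9CoReadingCoordsS (XSK blkSK sIK)
open Node00 (SiteY FBondY IBondY)
open Node00.OpsYNablaBridge (chartY dirSliceK slotCopyK coordOpK_apply4 assembleK_slotCopyK DvcoKH_apply_eq GcoS_DvscoKH_apply_eq_sum)
open B9CoReadingCoords (assembleK assembleK_smul assembleK_coordOpK coordOpK)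
open B9CoReadingCoordsS (GcoS DcoS DscoS)
open Node00.OpsYSectDCoords (DvcoKH DvscoKH)
open Node00 (CfgY SiteOpY etaS)
open B9Ineq349SiteComposite (cdSL cdsSL etaS_pos)
open B9Eq340ProbeBridgeDstarSN (assembleK_of_dirSum)
open B9Thm312Whole (GeoOK)
open B9Thm312WholeClasses (cNormR cNormR_loc cNormR_isLoc)
open B9SmoothHolderClassTClosure (abs_apply_le_of_hasMaj_cNormR)
open B9GradViaDivLettersAtPinsHolderPairs (sIK_chartY)
open B11SectG (BlockNorm HasMaj)

variable {d ℓ : ℕ} {hd : 1 ≤ d + 1} {hL : Odd (ℓ + 1) ∧ 1 < ℓ + 1} {b₀ b₁ : ℝ}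
variable {κ : Type} [Fintype κ]
variable (i : KIdx d ℓ hd hL b₀ b₁) [Fintype (geo9K i).Site] {bI : FBondY i → IBondY i} {R₀ : ℝ} {H₀ : Prop}
variable {F₁ : Type} [AddCommGroup F₁] [Module ℝ F₁]

/-- the sharp-block sup of `f` at `y` is below any `M ≥ 0` bounding `|f|` on the block. [folklore] -/
private theorem ofBlocks_loc_le_of_forall {X : Type} [Fintype X] (blk : X → IBondY i) {y : IBondY i}
    {f : X → ℝ} {M : ℝ} (hM : 0 ≤ M) (h : ∀ x, blk x = y → |f x| ≤ M) : (BlockNorm.ofBlocks (toB6 (geo9K i) R₀ H₀) blk).loc y f ≤ M := by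
  classical
  show (⨆ x : X, @ite ℝ (blk x = y) (Classical.propDecidable _) |f x| 0) ≤ M
  refine Real.iSup_le (fun x => ?_) hM
  split_ifs with hx
  · exact h x hx
  · exact hM

/-- ★★ **THE BOND READ-OFF OF A DIRECTION-INDEXED FAMILY.**  For ANY source class `b₁`, a direction-blind bond block map `bI`, a real weight `t`: if every site-packed word `S μ` is
bounded `b₁ → 𝔠^{(t)}_{blkSK(sIK bI)}` by `C e^{−δd}` (family indexed by the bond direction, the bond slot and the summed direction) and the bond word `T′` reads `T′ A (⟨x,dir⟩, ν, c, c′) = γ·Σ_μ S dir ν μ A (chart x, μ, c, c′)`, then `T′` is bounded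
`b₁ → 𝔠^{(t)}_{blkBK bI}` by `(d+1)|γ|·C e^{−δd}` (the bond `⟨x, dir⟩` and the site `chart x` share the block; triangle inequality over the `d + 1` directions).
[cite: Balaban1985BackgroundPropagators, (3.8) p.392 + (3.44) p.398; Balaban1984PropagatorsII, (2.51)–(2.52) p.232] -/
theorem hasMaj_bond_of_dirSumFamily (hG : GeoOK (geo9K i)) (hbI0 : ∀ x : FBondY i, bI x = bI ⟨x.src, 0⟩)
    {b₁ : BlockNorm (toB6 (geo9K i) R₀ H₀) F₁} (S : Fin (d + 1) → Fin (d + 1) → Fin (d + 1) → F₁ →ₗ[ℝ] (XSK κ i → ℝ))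
    {T' : F₁ →ₗ[ℝ] (XBK κ i → ℝ)} {γ : ℝ}
    (hT : ∀ (A : F₁) (x : FBondY i) (ν : Fin (d + 1)) (c c' : κ),
      T' A (x, ν, c, c') = γ * ∑ μ : Fin (d + 1), S x.dir ν μ A (chartY i x.src, μ, c, c'))
    {t C δ : ℝ} (hC : 0 ≤ C)
    (hS : ∀ dir ν μ : Fin (d + 1), HasMaj b₁ (cNormR R₀ H₀ (blkSK i (sIK i bI)) hG.lenle t) (S dir ν μ) (fun a a' => C * Real.exp (-(δ * (geo9K i).dist a a')))) :
    HasMaj b₁ (cNormR R₀ H₀ (blkBK i bI) hG.lenle t) T' (fun a a' => ((d + 1 : ℕ) : ℝ) * |γ| * C * Real.exp (-(δ * (geo9K i).dist a a'))) := by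
  classical
  intro y' A hA y
  have hl0 : 0 ≤ b₁.loc y' A := b₁.loc_nonneg _ _
  have hlen : 0 < (geo9K i).len y := geo9K_len_pos i y
  -- the site anchor of a bond's base point IS the bond's block (direction-blind `bI`)
  have hanchor : ∀ x : FBondY i, sIK i bI (chartY i x.src) = bI x := by
    intro x; rw [sIK_chartY, ← hbI0 x]
  -- every bond value anchored at `y`
  have hpt : ∀ q : XBK κ i, blkBK i bI q = y →
      |T' A q| ≤ ((geo9K i).len y ^ t)⁻¹ * (((d + 1 : ℕ) : ℝ) * |γ| * C * Real.exp (-(δ * (geo9K i).dist y y'))) * b₁.loc y' A := by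
    rintro ⟨x, ν, c, c'⟩ hq
    have hx : bI x = y := hq
    rw [hT, abs_mul]
    have hterm : ∀ μ : Fin (d + 1), |S x.dir ν μ A (chartY i x.src, μ, c, c')| ≤
        ((geo9K i).len y ^ t)⁻¹ * (C * Real.exp (-(δ * (geo9K i).dist y y'))) * b₁.loc y' A := by
      intro μ
      have hv := abs_apply_le_of_hasMaj_cNormR i hG.lenle (hS x.dir ν μ) hA (chartY i x.src, μ, c, c')
      have hblk : blkSK i (sIK i bI) (chartY i x.src, μ, c, c') = y := by
        show sIK i bI (chartY i x.src) = y; rw [hanchor x, hx]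
      rw [hblk] at hv
      exact hv
    calc |γ| * |∑ μ : Fin (d + 1), S x.dir ν μ A (chartY i x.src, μ, c, c')|
        ≤ |γ| * ∑ μ : Fin (d + 1), |S x.dir ν μ A (chartY i x.src, μ, c, c')| := mul_le_mul_of_nonneg_left (Finset.abs_sum_le_sum_abs _ _) (abs_nonneg _)
      _ ≤ |γ| * ∑ _μ : Fin (d + 1), ((geo9K i).len y ^ t)⁻¹ * (C * Real.exp (-(δ * (geo9K i).dist y y'))) * b₁.loc y' A :=
          mul_le_mul_of_nonneg_left (Finset.sum_le_sum fun μ _ => hterm μ) (abs_nonneg _)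
      _ = ((geo9K i).len y ^ t)⁻¹ * (((d + 1 : ℕ) : ℝ) * |γ| * C * Real.exp (-(δ * (geo9K i).dist y y'))) * b₁.loc y' A := by
          rw [Finset.sum_const, Finset.card_univ, Fintype.card_fin, nsmul_eq_mul]; push_cast; ring
  have hK0 : 0 ≤ ((geo9K i).len y ^ t)⁻¹ * (((d + 1 : ℕ) : ℝ) * |γ| * C * Real.exp (-(δ * (geo9K i).dist y y'))) * b₁.loc y' A := by
    have := Real.rpow_nonneg hlen.le t; positivity
  have hloc := ofBlocks_loc_le_of_forall i (R₀ := R₀) (H₀ := H₀) (blkBK i bI) hK0 hpt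
  rw [cNormR_loc]
  calc (geo9K i).len y ^ t * (BlockNorm.ofBlocks (toB6 (geo9K i) R₀ H₀) (blkBK i bI)).loc y (T' A)
      ≤ (geo9K i).len y ^ t * (((geo9K i).len y ^ t)⁻¹ * (((d + 1 : ℕ) : ℝ) * |γ| * C * Real.exp (-(δ * (geo9K i).dist y y'))) * b₁.loc y' A) :=
        mul_le_mul_of_nonneg_left hloc (Real.rpow_nonneg hlen.le _)
    _ = ((d + 1 : ℕ) : ℝ) * |γ| * C * Real.exp (-(δ * (geo9K i).dist y y')) * b₁.loc y' A := by
        have hne : (geo9K i).len y ^ t ≠ 0 := (Real.rpow_pos_of_pos hlen t).ne'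
        field_simp

/-- ★ the single-word form (`S μ = S` for all `μ`). [cite: Balaban1985BackgroundPropagators, (3.8) p.392 + (3.44) p.398; Balaban1984PropagatorsII, (2.51)–(2.52) p.232] -/
theorem hasMaj_bond_of_dirSum (hG : GeoOK (geo9K i)) (hbI0 : ∀ x : FBondY i, bI x = bI ⟨x.src, 0⟩)
    {b₁ : BlockNorm (toB6 (geo9K i) R₀ H₀) F₁} (S : F₁ →ₗ[ℝ] (XSK κ i → ℝ)) {T' : F₁ →ₗ[ℝ] (XBK κ i → ℝ)} {γ : ℝ}
    (hT : ∀ (A : F₁) (x : FBondY i) (ν : Fin (d + 1)) (c c' : κ), T' A (x, ν, c, c') = γ * ∑ μ : Fin (d + 1), S A (chartY i x.src, μ, c, c'))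
    {t C δ : ℝ} (hC : 0 ≤ C)
    (hS : HasMaj b₁ (cNormR R₀ H₀ (blkSK i (sIK i bI)) hG.lenle t) S (fun a a' => C * Real.exp (-(δ * (geo9K i).dist a a')))) :
    HasMaj b₁ (cNormR R₀ H₀ (blkBK i bI) hG.lenle t) T' (fun a a' => ((d + 1 : ℕ) : ℝ) * |γ| * C * Real.exp (-(δ * (geo9K i).dist a a'))) :=
  hasMaj_bond_of_dirSumFamily i hG hbI0 (fun _ _ _ => S) hT hC fun _ _ _ => hS

/-! ## §2 The certificate's bond word `∇_U ∘ G′ ∘ ∇\*_U` at def-Y's pins IS such a direction sum of n06-k's directional words -/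

section Identity

variable {𝔸 : Type} [NormedRing 𝔸] [NormedAlgebra ℂ 𝔸] [CompleteSpace 𝔸] [FiniteDimensional ℝ 𝔸]
variable (b : Module.Basis κ ℝ 𝔸) {B : B9.Backgrounds} (cfg : B.Cfg → CfgY 𝔸 i) (O : SiteOpY 𝔸 i) (U₁ : B.Cfg)

omit [Fintype (geo9K i).Site] in
/-- the assembled slot value of `G′` applied to `DscoS F` and to the engine's constant-family `∇\*_{U,μ}` pin agree at slot `μ` (both read `∇\*_{U,μ}` of slot `μ`).
[cite: Balaban1985BackgroundPropagators, (3.8) p.392 + (3.42) p.397, bookkeeping] -/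
theorem assembleK_GcoS_DscoS_eq (F : XSK κ i → ℝ) (μ : Fin (d + 1)) (c' : κ) :
    assembleK b μ c' (GcoS i b B cfg O U₁ (DscoS i b B cfg U₁ F)) =
      assembleK b μ c' (GcoS i b B cfg O U₁ ((etaS i)⁻¹ • coordOpK b (fun _ : Fin (d + 1) => (cdsSL i (cfg U₁) μ).restrictScalars ℝ) F)) := by
  simp only [GcoS, DscoS, LinearMap.smul_apply, assembleK_smul, assembleK_coordOpK, map_smul]

omit [Fintype (geo9K i).Site] in
/-- ★★ **`(𝔬12).Dv ∘ GcoS G′ ∘ (𝔬12).Dvstar` IS `(c_fη)²·Σ_μ` OF THE DIRECTIONAL WORDS `∇_{U,dir} ∘ G′ ∘ ∇\*_{U,μ}` ON THE SLICES** (def-Y's pins `DvcoKH ∕ DvscoKH`, n06-k's pins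
`𝔡.Dd U dir = η⁻¹•coordOpK b (fun _ => ∇_{U,dir})`, `𝔡.Dsd U μ = η⁻¹•coordOpK b (fun _ => ∇\*_{U,μ})`): the `hT` of `hasMaj_bond_of_dirSumFamily` for the certificate's `h44G` word.
[cite: Balaban1985BackgroundPropagators, (3.8) p.392 + (3.42) p.397 + (3.44) p.398] -/
theorem DvGcoSDvs_apply_eq_dirSum (A : XBK κ i → ℝ) (x : FBondY i) (ν : Fin (d + 1)) (c c' : κ) :
    (DvcoKH i b B cfg U₁ ∘ₗ (GcoS i b B cfg O U₁ ∘ₗ DvscoKH i b B cfg U₁)) A (x, ν, c, c') =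
      (i.cf * etaS i) ^ 2 * ∑ μ : Fin (d + 1),
        ((((etaS i)⁻¹ • coordOpK b (fun _ : Fin (d + 1) => (cdSL i (cfg U₁) x.dir).restrictScalars ℝ)) ∘ₗ
            (GcoS i b B cfg O U₁ ∘ₗ ((etaS i)⁻¹ • coordOpK b (fun _ : Fin (d + 1) => (cdsSL i (cfg U₁) μ).restrictScalars ℝ)))) ∘ₗ
          dirSliceK i μ ν) A (chartY i x.src, μ, c, c') := by
  -- the assembled `ν`-slot function of `W A`, `W = GcoS ∘ DvscoKH`, as a direction sum
  have hW : assembleK b ν c' ((GcoS i b B cfg O U₁ ∘ₗ DvscoKH i b B cfg U₁) A) =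
      (i.cf * etaS i) • ∑ μ : Fin (d + 1), assembleK b μ c' ((GcoS i b B cfg O U₁ ∘ₗ DscoS i b B cfg U₁) (dirSliceK i μ ν A)) := by
    funext z
    rw [assembleK_of_dirSum i b (T' := GcoS i b B cfg O U₁ ∘ₗ DvscoKH i b B cfg U₁) (T := GcoS i b B cfg O U₁ ∘ₗ DscoS i b B cfg U₁)
      (γ := i.cf * etaS i) (GcoS_DvscoKH_apply_eq_sum i b B cfg O U₁) A ν c' z, Pi.smul_apply, Finset.sum_apply]
  rw [LinearMap.comp_apply, DvcoKH_apply_eq, DcoS, LinearMap.smul_apply, Pi.smul_apply, smul_eq_mul, coordOpK_apply4, LinearMap.restrictScalars_apply,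
    assembleK_slotCopyK, hW, LinearMap.map_smul_of_tower, map_sum, Pi.smul_apply, Finset.sum_apply, map_smul, map_sum, Finsupp.smul_apply,
    Finsupp.coe_finsetSum, Finset.sum_apply, smul_eq_mul, Finset.mul_sum, Finset.mul_sum, Finset.mul_sum, Finset.mul_sum]
  refine Finset.sum_congr rfl fun μ _ => ?_
  rw [LinearMap.comp_apply, LinearMap.comp_apply, LinearMap.comp_apply, LinearMap.smul_apply, Pi.smul_apply, smul_eq_mul, coordOpK_apply4,
    LinearMap.restrictScalars_apply, LinearMap.comp_apply, LinearMap.smul_apply, ← assembleK_GcoS_DscoS_eq]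
  ring

end Identity

end Literature.MathematicalPhysics.QuantumFieldTheory.Balaban1983to89.B9Eq340DirSumReadOff

end
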